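import Literature.NumberTheory.Automorphic.CMPrincipalSeriesTraceOrbitalForm        -- ★ (4.9.4): the frame `cmDatumLocalCongr`, carriers, `classOrbitalIntegral`
import Literature.NumberTheory.Rogawski1990.RegularOrbitalIntegralLocallyConstantCM     -- ★ `eventually_classOrbitalIntegral_mk_eq_cmDatum_local` (regular orbital integrals are locally constant along the torus)
import Literature.NumberTheory.Automorphic.JacquetNonzeroEmbedsNormalizedInd          -- ★ `torusU_mul_comm`
import HarnessLib

/-!
# F0 · P3c · line LH6 «StCharTS» — road (D), brick D3-ii (B-ii)(p2): the canonical orbital integral `t ↦ O_{⟦e t⟧}(f)` is LOCALLY CONSTANT on the regular part of the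
# split torus `M` (pull-back of ★ `RegularOrbitalIntegralLocallyConstantCM` along the frame `e` and the inclusion `M ↪ Z(e t₀)`)

Cell `pub/hodgecm-mathlib`, crux H413 = `stmt-HodgeConjecture-24833` (lane `--supports … --as helper`); seat LH2-p03 (g3); road (D) owner LH6-p04 (g2), dealer F0P3b-plan (g23).
THEOREMS ONLY, sorry-free, ★-only imports.  HONEST LABEL: HC_CM is proved only modulo the 7 printed citations (2 remaining: hLiu418 = stmt-HodgeConjecture-24832, h413 =
stmt-HodgeConjecture-24833) until rung 0 closes; count-neutral; this is ONE input (p2) of the PRODUCER of the locally constant representative `Ψ` consumed by ★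
`F0P3cStCharTSShellOrbitalG.normalizedOrbitalIntegral_eq_twoCoset` (p849606); the others ((p1) canonical diagonal writings, local constancy of `δ`, `J₃`; (p3) compact support
off the walls from ★ D3-i) remain.

THE MATHEMATICS ([HarishChandra1970, Part I §3]; [Rogawski1990, §4.9 p. 54]).  `M` is commutative (★ `torusU_mul_comm`), so for `t₀, t ∈ M` the frame images `e t`, `e t₀`
commute: `e t ∈ Z(e t₀)`, and `t ↦ ⟨e t, _⟩ : M → Z(e t₀)` is continuous.  If `e t₀` is regular semisimple, ★ `eventually_classOrbitalIntegral_mk_eq_cmDatum_local` says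
`s ↦ O_{⟦s⟧}(f)` is eventually constant near `⟨e t₀, _⟩` in `Z(e t₀)` for every `f ∈ C_c^∞` (★ `IsLocSmooth`) and every CANONICAL family `m_G`; pulling back,
`t ↦ O_{⟦e t⟧}(f)` is eventually equal to `O_{⟦e t₀⟧}(f)` near `t₀` in `M`.

## References
* [HarishChandra1970] Harish-Chandra, *Harmonic analysis on reductive p-adic groups*, LNM 162 (1970), Part I §3 Lemmas 13–14.
* [Rogawski1990] J. D. Rogawski, *Automorphic Representations of Unitary Groups in Three Variables* (1990), §4.3 (4.3.1) p. 43; §4.9 p. 54; §12.5 p. 183.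
-/

set_option autoImplicit false
set_option linter.dupNamespace false

noncomputable section

open NumberField IsDedekindDomain MeasureTheory Topology Filter Set
open scoped Matrix MatrixGroups
open Literature.MeasureTheory.Group Literature.NumberTheory.Automorphic Literature.NumberTheory.Automorphic.UnitaryGroup
open Literature.NumberTheory.Rogawski1990

namespace Summit.HodgeConjecture.HodgeConjecture.Cruxes.H413.F0P3cStCharTSShellOrbitalG

variable (L : Type) [Field L] [NumberField L] [IsCMField L]

set_option maxHeartbeats 1600000 in
set_option synthInstance.maxHeartbeats 400000 in
/-- **(p2) THE CANONICAL ORBITAL INTEGRAL IS LOCALLY CONSTANT ALONG THE REGULAR PART OF THE SPLIT TORUS.**  Binders of ★ (4.9.4) (`H hH hHd v w hw T a ha h`, σ-algebras,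
`ν_G`, canonical `m_G`), `f ∈ C_c^∞(U(H)(L⁺_v))` (★ `IsLocSmooth`), `t₀ ∈ M` with `e t₀` regular semisimple: `∀ᶠ t in 𝓝 t₀, O_{⟦e t⟧}(f) = O_{⟦e t₀⟧}(f)`.
[cite: HarishChandra1970, Part I §3 Lemmas 13–14] [cite: Rogawski1990, §4.9 p. 54; §12.5 p. 183] -/
theorem eventually_classOrbitalIntegral_congr_eq
    (H : Matrix (Fin 3) (Fin 3) L) (hH : (H.map (IsCMField.complexConj L))ᵀ = H) (hHd : IsUnit H.det)
    {v : HeightOneSpectrum (𝓞 ↥(maximalRealSubfield L))} (w : PlacesOver L v) (hw : IsCMField.complexConj L • w.1 = w.1)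
    (T : GL (Fin 3) (LocalRing L v)) {a : LocalRing L v} (ha : IsUnit a)
    (h : formCongr (conjLocal L (IsCMField.complexConj L) v) T (H.map (algebraMap L (LocalRing L v))) =
      a • (Matrix.of fun i j : Fin 3 => if i.val + j.val + 1 = 3 then (1 : L) else 0).map (algebraMap L (LocalRing L v)))
    [MeasurableSpace ((cmDatum L 3 H).Local v)] [BorelSpace ((cmDatum L 3 H).Local v)]
    [∀ γ : (cmDatum L 3 H).Local v, MeasurableSpace (((cmDatum L 3 H).Local v) ⧸ Subgroup.centralizer ({γ} : Set ((cmDatum L 3 H).Local v)))]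
    [∀ γ : (cmDatum L 3 H).Local v, BorelSpace (((cmDatum L 3 H).Local v) ⧸ Subgroup.centralizer ({γ} : Set ((cmDatum L 3 H).Local v)))]
    (νG : Measure ((cmDatum L 3 H).Local v)) [νG.IsHaarMeasure] [νG.IsMulRightInvariant]
    {mG : OrbitalMeasureFamily ((cmDatum L 3 H).Local v)}
    (hmG : mG.IsCanonical (fun γ => IsRegularElt (γ.val : GL (Fin 3) (LocalRing L v))) νG)
    {f : ((cmDatum L 3 H).Local v) → ℂ} (hf : IsLocSmooth f)
    (t₀ : ↥(cmBorelTriple L 3 v).M) (ht₀ : IsRegularElt ((Subtype.val ((cmDatumLocalCongr L v T ha h) (t₀ : ↥(unitaryGroupOfForm (conjLocal L (IsCMField.complexConj L) v) (cmLocalForm L 3 v))))) : GL (Fin 3) (LocalRing L v))) :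
    ∀ᶠ t : ↥(cmBorelTriple L 3 v).M in 𝓝 t₀,
      classOrbitalIntegral mG f (ConjClasses.mk ((cmDatumLocalCongr L v T ha h) (t : ↥(unitaryGroupOfForm (conjLocal L (IsCMField.complexConj L) v) (cmLocalForm L 3 v))))) = classOrbitalIntegral mG f (ConjClasses.mk ((cmDatumLocalCongr L v T ha h) (t₀ : ↥(unitaryGroupOfForm (conjLocal L (IsCMField.complexConj L) v) (cmLocalForm L 3 v))))) := by
  -- the inclusion `ι : M → Z(e t₀)`, `t ↦ e t` (M is commutative)
  have hmem : ∀ t : ↥(cmBorelTriple L 3 v).M, (cmDatumLocalCongr L v T ha h) (t : ↥(unitaryGroupOfForm (conjLocal L (IsCMField.complexConj L) v) (cmLocalForm L 3 v))) ∈ Subgroup.centralizer ({(cmDatumLocalCongr L v T ha h) (t₀ : ↥(unitaryGroupOfForm (conjLocal L (IsCMField.complexConj L) v) (cmLocalForm L 3 v)))} : Set ((cmDatum L 3 H).Local v)) := by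
    intro t
    rw [Subgroup.mem_centralizer_singleton_iff, ← map_mul, ← map_mul]
    congr 1
    have hc := torusU_mul_comm _ _ t t₀
    exact (congrArg Subtype.val hc).trans (by rfl)
  let ι : ↥(cmBorelTriple L 3 v).M → ↥(Subgroup.centralizer ({(cmDatumLocalCongr L v T ha h) (t₀ : ↥(unitaryGroupOfForm (conjLocal L (IsCMField.complexConj L) v) (cmLocalForm L 3 v)))} : Set ((cmDatum L 3 H).Local v))) := fun t => ⟨(cmDatumLocalCongr L v T ha h) (t : ↥(unitaryGroupOfForm (conjLocal L (IsCMField.complexConj L) v) (cmLocalForm L 3 v))), hmem t⟩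
  have hι : Continuous ι :=
    ((cmDatumLocalCongr L v T ha h).continuous.comp continuous_subtype_val).subtype_mk _
  -- ★ local constancy along `Z(e t₀)` at the point `ι t₀`, pulled back along `ι`
  have hev := eventually_classOrbitalIntegral_mk_eq_cmDatum_local L H hH hHd w hw hmG ht₀ hf (ι t₀) ht₀
  exact (hι.tendsto t₀).eventually hev

end Summit.HodgeConjecture.HodgeConjecture.Cruxes.H413.F0P3cStCharTSShellOrbitalG

end
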